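import Literature.NumberTheory.LFunctions.SekatskiiGeneralizedLiCriterionProofs
import Literature.Analysis.SpecialFunctions.PolygammaSeries
import Mathlib.NumberTheory.LSeries.Deriv
import HarnessLib

/-!
# Sekatskii's arithmetic formula for the generalized Li sums `k_{n,a}` — proof of Theorem 7 of [Sekatskii2014]

LABEL (line 1): **RH-FREE** theorems (second proofs file of
`Literature/NumberTheory/LFunctions/SekatskiiGeneralizedLiCriterion.lean`; S. K. Sekatskii, Ukr. Math.
J. **66** (2014) 415–431 [Sekatskii2014], §4).  bears_on: LADDER-RH L-C/L-P (COLUMN 4, LI).  WHAT THIS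
IS NOT: the identity proved here makes the statement file's `riemannHypothesis_iff_liSekatskiiArith_nonneg`
("RH `⟺` every `liSekatskiiArith a n ≥ 0`", real `a > 1`) hypothesis-free; that record RE-INDEXES Li's
criterion (every series in it converges absolutely, but the positivity of the whole family is RH
itself), it is not worded as, and is not, progress toward RH; nothing here bears on the truth of RH.

## Contents

* `Sekatskii2014_thm7_holds` — **Theorem 7, eq. (10) (p. 429), DISCHARGED** (real `a > 1`, `n ≥ 1`):
  `k_{n,a} = 2 − (−1 + 1/a)ⁿ − (−1 − 1/(a−1))ⁿ
    + Σ_{j=1}^{n} C(n,j)(2a−1)^j ((−1)^j/(j−1)!) Σ_{m≥1} Λ(m) ln^{j−1}m / m^a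
    + (n/2)(2a−1)(ψ(a/2) − ln π) + Σ_{j=2}^{n} C(n,j)(−1)^j 2^{−j}(2a−1)^j ζ(j, a/2)`
  (`liSekatskiiSum a n = liSekatskiiArith a n`), and the hypothesis-free
  `riemannHypothesis_iff_liSekatskiiArith_nonneg'`.

  ROAD (deviation from print, recorded): Sekatskii derives (10) from the Bombieri–Lagarias form of
  Weil's explicit formula ((8)–(9), p. 426) applied to the inverse Mellin transform `g_{n,a}` of
  `1 − (1 − (2a−1)/(s+a−1))ⁿ` (Lemma 1, p. 425), evaluating the resulting integrals with
  Gradshteyn–Ryzhik 4.272.6 / 3.244.3 (pp. 427–428) and "collecting everything together" with the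
  binomial sums `Σ_j C(n,j)(−1)^{j−1}(2a−1)^j a^{−j} = −1 − (−1 + 1/a)ⁿ` (p. 429, top).  The tree
  offers a genuinely shorter road to the same identity: by eq. (6) (`Sekatskii2014_sum_eq_deriv_holds`,
  sibling proofs file) `k_{n,a} = (1−2a)·(1/(n−1)!) dⁿ/dzⁿ[(z−a)^{n−1} ln ξ(z)]|_{z=1−a}`; by
  `ξ(z) = ξ(1−z)` the derivatives of `ln ξ` at `1 − a` are `(−1)^k` times those at `a > 1`
  (`iteratedDeriv_log_riemannXi_one_sub`); Leibniz' rule (`Sekatskii2014Eq6.iteratedDeriv_sub_pow_mul_eq_sum_at`)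
  reduces everything to `(ξ′/ξ)^{(j)}(a)`, `0 ≤ j < n`, and on `Re s > 1` the tree has
  `ξ′/ξ(s) = 1/s + 1/(s−1) − ½ ln π + ½ψ(s/2) − Σ Λ(m)m^{−s}` (`logDeriv_riemannXi_eq_of_one_lt_re`),
  whose `j`-th derivatives are `(−1)^j j!(a^{−j−1} + (a−1)^{−j−1})`, the polygamma series
  `(ψ(·/2)/2)^{(j)}(a) = (−1)^{j+1} j! Σ_{m≥0}(a+2m)^{−j−1}`
  (`Literature.Analysis.SpecialFunctions.Complex.hasSum_iteratedDeriv_digamma_half`) and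
  `(−1)^{j+1} Σ Λ(m) ln^j m · m^{−a}` (Mathlib `LSeries_iteratedDeriv`).  The binomial theorem then
  produces exactly Sekatskii's closed terms `2 − (−1+1/a)ⁿ − (−1−1/(a−1))ⁿ` (his p. 429 display) and
  the three printed sums.  The case `n = 1` is the classical
  `Σ_ρ 1/(a−ρ) = 1/a + 1/(a−1) − Σ Λ(m)m^{−a} + ½(ψ(a/2) − ln π)` (Remark 5, p. 429).

## References

* S. K. Sekatskii, Ukr. Math. J. 66 (2014) 415–431, §4 Thm 7, eq. (10), Remark 5 (p. 429)
  (held: `paper:doi-10-1007-s11253-014-0940-9`, PDF pp. 13–15). [Sekatskii2014]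
* E. Bombieri, J. C. Lagarias, J. Number Theory 77 (1999) 274–287 (the arithmetic formula for
  `λ_n`, the case `a → 1`). [BombieriLagarias1999]
* G. E. Andrews, R. Askey, R. Roy, *Special Functions*, CUP 1999, (1.2.14) (polygamma series).
  [AndrewsAskeyRoy1999]
-/

noncomputable section

open Complex Filter Topology Set Metric LSeries
open scoped Nat ComplexConjugate ComplexOrder LSeries.notation ArithmeticFunction.vonMangoldt

namespace Literature.NumberTheory.LFunctions

namespace Sekatskii2014Thm7

open Sekatskii2014Eq6
open Literature.Analysis.SpecialFunctions.Complex (hasSum_iteratedDeriv_digamma_half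
  differentiableOn_digamma)

/-! ## The derivatives of `log ξ` at `1 − a` and at `a` -/

/-- `(log ξ)^{(k)}(1 − z) = (−1)^k (log ξ)^{(k)}(z)` (differentiate `ξ(1 − s) = ξ(s)` `k` times).
[cite: Sekatskii2014, §4 (the symmetry `k_{n,1−a} = k_{n,a}`, eq. (11) p. 430)] -/
theorem iteratedDeriv_log_riemannXi_one_sub (k : ℕ) (z : ℂ) :
    iteratedDeriv k (fun s ↦ Complex.log (riemannXi s)) (1 - z) =
      (-1) ^ k * iteratedDeriv k (fun s ↦ Complex.log (riemannXi s)) z := by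
  have hfe : (fun s : ℂ ↦ Complex.log (riemannXi s)) =
      fun s ↦ (fun w ↦ Complex.log (riemannXi w)) (1 - s) := by
    funext s; simp only [riemannXi_one_sub]
  conv_lhs => rw [hfe, iteratedDeriv_comp_const_sub k (fun w ↦ Complex.log (riemannXi w)) 1]
  simp only [sub_sub_cancel, smul_eq_mul]

/-- Near a real point the principal `log ξ` is a primitive of `ξ'/ξ` (`ξ > 0` on `ℝ`), hence
`(log ξ)^{(j+1)}(p) = (ξ'/ξ)^{(j)}(p)`. [folklore] -/
private theorem iteratedDeriv_succ_log_riemannXi_ofReal (p : ℝ) (j : ℕ) :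
    iteratedDeriv (j + 1) (fun s ↦ Complex.log (riemannXi s)) p =
      iteratedDeriv j (logDeriv riemannXi) p := by
  rw [iteratedDeriv_succ']
  refine Filter.EventuallyEq.iteratedDeriv_eq j ?_
  have h1 : riemannXi p ∈ slitPlane :=
    mem_slitPlane_iff.2 (Or.inl (Complex.pos_iff.1 (riemannXi_ofReal_pos p)).1)
  have hV : ∀ᶠ s in 𝓝 (p : ℂ), riemannXi s ∈ slitPlane :=
    differentiable_riemannXi.continuous.continuousAt.eventually_mem (isOpen_slitPlane.mem_nhds h1)
  filter_upwards [hV] with s hs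
  rw [((differentiable_riemannXi s).hasDerivAt.clog hs).deriv, logDeriv_apply]

/-! ## `ξ'/ξ` and its derivatives at a real point `a > 1` -/

/-- `ξ'/ξ` near a real `a > 1`: `1/s + 1/(s−1) + (−½ log π + ½ ψ(s/2)) − Σ Λ(m) m^{−s}`
(`logDeriv_riemannXi_eq_of_one_lt_re` on the open half-plane `Re s > 1`). [folklore] -/
private theorem logDeriv_riemannXi_eventuallyEq {a : ℝ} (ha : 1 < a) :
    logDeriv riemannXi =ᶠ[𝓝 (a : ℂ)] fun s ↦ (1 * s - 0)⁻¹ + (1 * s - 1)⁻¹ +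
      (-(Real.log Real.pi : ℂ) / 2 + digamma (s / 2) / 2) - L ↗Λ s := by
  have hopen : IsOpen {z : ℂ | 1 < z.re} := isOpen_lt continuous_const Complex.continuous_re
  have ha' : (a : ℂ) ∈ {z : ℂ | 1 < z.re} := by simpa using ha
  filter_upwards [hopen.mem_nhds ha'] with z hz
  rw [logDeriv_riemannXi_eq_of_one_lt_re hz]
  simp only [one_mul, sub_zero, one_div]
  ring

/-- `dʲ/dsʲ (s − d)⁻¹ |_{s=c} = (−1)ʲ j! (c − d)^{−(j+1)}` (Mathlib's `iter_deriv_inv_linear_sub`).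
[folklore] -/
private theorem iteratedDeriv_inv_linear (j : ℕ) (d c : ℂ) :
    iteratedDeriv j (fun s : ℂ ↦ (1 * s - d)⁻¹) c = (-1) ^ j * j ! * ((c - d)⁻¹) ^ (j + 1) := by
  rw [iteratedDeriv_eq_iterate, iter_deriv_inv_linear_sub j 1 d]
  simp only [one_pow, mul_one, one_mul]
  have ez : ∀ w : ℂ, w ^ (-1 - j : ℤ) = (w⁻¹) ^ (j + 1) := by
    intro w
    rw [show (-1 - j : ℤ) = -((j + 1 : ℕ) : ℤ) by push_cast; ring, zpow_neg, zpow_natCast, inv_pow]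
  rw [ez]

/-- The digamma part `s ↦ −½ log π + ½ ψ(s/2)` of `ξ'/ξ` is smooth on `Re s > 0`. [folklore] -/
private theorem contDiffAt_digammaPiece {c : ℂ} (hc : 0 < c.re) (k : ℕ) :
    ContDiffAt ℂ k (fun s : ℂ ↦ -(Real.log Real.pi : ℂ) / 2 + digamma (s / 2) / 2) c := by
  have hU : IsOpen {w : ℂ | 0 < w.re} := isOpen_lt continuous_const continuous_re
  have hd : DifferentiableOn ℂ (fun s : ℂ ↦ -(Real.log Real.pi : ℂ) / 2 + digamma (s / 2) / 2)
      {w : ℂ | 0 < w.re} := by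
    intro w hw
    have hw' : 0 < w.re := hw
    have hw2 : 0 < (w / 2).re := by simp; linarith
    have h1 : DifferentiableAt ℂ digamma (w / 2) :=
      (differentiableOn_digamma (w / 2) hw2).differentiableAt (hU.mem_nhds hw2)
    exact (((h1.comp w (differentiableAt_id.div_const 2)).div_const 2).const_add
      _).differentiableWithinAt
  exact (hd.analyticAt (hU.mem_nhds hc)).contDiffAt

/-- The abscissa of absolute convergence of `Σ Λ(m) m^{−s}` is `≤ 1 < a`. [folklore] -/
private theorem abscissa_lt {a : ℝ} (ha : 1 < a) : LSeries.abscissaOfAbsConv ↗Λ < ((a : ℂ)).re := by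
  have h1 : LSeries.abscissaOfAbsConv ↗Λ ≤ 1 :=
    LSeries.abscissaOfAbsConv_le_of_forall_lt_LSeriesSummable fun y hy ↦
      ArithmeticFunction.LSeriesSummable_vonMangoldt (by simpa using hy)
  refine lt_of_le_of_lt h1 ?_
  rw [Complex.ofReal_re]
  exact_mod_cast ha

/-- **The derivatives of `ξ'/ξ` at a real point `a > 1`**:
`(ξ'/ξ)^{(j)}(a) = (−1)^j j! (a^{−j−1} + (a−1)^{−j−1}) + (−½ log π + ½ψ(·/2))^{(j)}(a) − (−1)^j L(logʲ·Λ)(a)`.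
[cite: Sekatskii2014, Remark 5 p. 429 (the case j = 0)] -/
theorem iteratedDeriv_logDeriv_riemannXi {a : ℝ} (ha : 1 < a) (j : ℕ) :
    iteratedDeriv j (logDeriv riemannXi) a =
      (-1) ^ j * j ! * ((((a : ℂ))⁻¹) ^ (j + 1) + (((a : ℂ) - 1)⁻¹) ^ (j + 1)) +
        iteratedDeriv j (fun s : ℂ ↦ -(Real.log Real.pi : ℂ) / 2 + digamma (s / 2) / 2) a -
        (-1) ^ j * L (logMul^[j] ↗Λ) a := by
  have habs := abscissa_lt ha
  have ha0 : 0 < ((a : ℂ)).re := by simp; linarith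
  have hane : (a : ℂ) ≠ 0 := Complex.ofReal_ne_zero.2 (by linarith)
  have hane1 : (a : ℂ) - 1 ≠ 0 := by
    rw [← Complex.ofReal_one, ← Complex.ofReal_sub]; exact Complex.ofReal_ne_zero.2 (by linarith)
  have h1 : ContDiffAt ℂ j (fun s : ℂ ↦ (1 * s - 0)⁻¹) a :=
    ContDiffAt.inv (by fun_prop) (by simpa using hane)
  have h2 : ContDiffAt ℂ j (fun s : ℂ ↦ (1 * s - 1)⁻¹) a :=
    ContDiffAt.inv (by fun_prop) (by simpa using hane1)
  have h3 := contDiffAt_digammaPiece ha0 j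
  have h4 : ContDiffAt ℂ j (L ↗Λ) a := (LSeries_analyticOnNhd ↗Λ a habs).contDiffAt
  rw [(logDeriv_riemannXi_eventuallyEq ha).iteratedDeriv_eq,
    iteratedDeriv_fun_sub ((h1.add h2).add h3) h4, iteratedDeriv_fun_add (h1.add h2) h3,
    iteratedDeriv_fun_add h1 h2, iteratedDeriv_inv_linear, iteratedDeriv_inv_linear,
    LSeries_iteratedDeriv j habs]
  simp only [sub_zero]
  ring

/-! ## Leibniz at `1 − a` and the reduction to `(ξ'/ξ)^{(j)}(a)` -/

/-- **The derivative behind `k_{n,a}`, reduced to `ξ'/ξ` at `a`**: for real `a` and `n ≥ 1`,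
`(1 − 2a) · (1/(n−1)!) dⁿ/dzⁿ[(z−a)^{n−1} log ξ(z)]|_{z=1−a}
  = Σ_{j<n} C(n,j+1) (2a−1)^{j+1}/j! · (ξ'/ξ)^{(j)}(a)`
(Leibniz' rule, `(z−a)^{n−1}` at `z = 1−a` giving `(1−2a)^{n−1−i}`, and
`(log ξ)^{(k)}(1−a) = (−1)^k (log ξ)^{(k)}(a)`). [cite: Sekatskii2014, eq. (6) p. 423 and §4] -/
theorem key_sum (a : ℝ) {n : ℕ} (hn : 1 ≤ n) :
    ((1 - 2 * a : ℝ) : ℂ) * (iteratedDeriv n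
        (fun z : ℂ ↦ (z - a) ^ (n - 1) * Complex.log (riemannXi z)) ((1 - a : ℝ) : ℂ) /
        ((n - 1)! : ℂ)) =
      ∑ j ∈ Finset.range n, (n.choose (j + 1) : ℂ) * (2 * a - 1) ^ (j + 1) / (j ! : ℂ) *
        iteratedDeriv j (logDeriv riemannXi) a := by
  have hg : ContDiffAt ℂ n (fun s ↦ Complex.log (riemannXi s)) ((1 - a : ℝ) : ℂ) :=
    (analyticAt_log_riemannXi_ofReal (1 - a)).contDiffAt
  rw [iteratedDeriv_sub_pow_mul_eq_sum_at hn _ _ hg, Finset.sum_div, Finset.mul_sum,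
    ← Finset.sum_range_reflect]
  refine Finset.sum_congr rfl fun j hj ↦ ?_
  have hj' : j < n := Finset.mem_range.1 hj
  have e1 : n - (n - 1 - j) = j + 1 := by omega
  have e2 : n - 1 - (n - 1 - j) = j := by omega
  rw [e1, e2, Nat.choose_symm_of_eq_add (by omega : n = (n - 1 - j) + (j + 1)),
    show ((1 - a : ℝ) : ℂ) = 1 - (a : ℂ) by push_cast; ring, iteratedDeriv_log_riemannXi_one_sub,
    iteratedDeriv_succ_log_riemannXi_ofReal]
  -- `(n−1)^{(n−1−j)} · j! = (n−1)!`
  have key : (((n - 1).descFactorial (n - 1 - j) : ℕ) : ℂ) * (j ! : ℂ) = ((n - 1)! : ℂ) := by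
    have h := Nat.factorial_mul_descFactorial (show n - 1 - j ≤ n - 1 by omega)
    rw [show n - 1 - (n - 1 - j) = j by omega, mul_comm] at h
    exact_mod_cast h
  have hj0 : (j ! : ℂ) ≠ 0 := by exact_mod_cast (Nat.factorial_pos j).ne'
  have hn0 : ((n - 1)! : ℂ) ≠ 0 := by exact_mod_cast (Nat.factorial_pos _).ne'
  have hdesc : (((n - 1).descFactorial (n - 1 - j) : ℕ) : ℂ) = ((n - 1)! : ℂ) / (j ! : ℂ) := by
    rw [eq_div_iff hj0, key]
  rw [hdesc]
  have epow : ((1 : ℂ) - a - a) ^ j * (-1) ^ (j + 1) * (1 - 2 * (a : ℂ)) =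
      (2 * a - 1) ^ (j + 1) := by
    calc ((1 : ℂ) - a - a) ^ j * (-1) ^ (j + 1) * (1 - 2 * (a : ℂ))
        = (-1) ^ (j + 1) * (1 - 2 * (a : ℂ)) ^ (j + 1) := by
          rw [show ((1 : ℂ) - a - a) = 1 - 2 * a by ring]; ring
      _ = ((-1) * (1 - 2 * (a : ℂ))) ^ (j + 1) := by rw [mul_pow]
      _ = (2 * a - 1) ^ (j + 1) := by congr 1; ring
  push_cast
  field_simp
  linear_combination ((n.choose (j + 1) : ℂ) * iteratedDeriv j (logDeriv riemannXi) a) * epow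

/-! ## The pieces of the arithmetic formula at a real point `a > 1` -/

/-- `logʲ·f`, iterated: `logMul^[j] f m = (log m)^j f m`. [folklore] -/
private theorem logMul_iterate_apply (f : ℕ → ℂ) (j m : ℕ) :
    (logMul^[j] f) m = (Complex.log m) ^ j * f m := by
  induction j with
  | zero => simp
  | succ j ih =>
    rw [Function.iterate_succ_apply']
    change Complex.log m * (logMul^[j] f) m = _
    rw [ih, pow_succ]
    ring

/-- The terms of `L(logʲ·Λ, a)` at a real point are the real numbers `Λ(m) (log m)^j / m^a`.
[folklore] -/
private theorem term_logPow_vonMangoldt (a : ℝ) (j m : ℕ) :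
    term (logMul^[j] ↗Λ) (a : ℂ) m =
      (((ArithmeticFunction.vonMangoldt m : ℝ) * Real.log m ^ j / (m : ℝ) ^ a : ℝ) : ℂ) := by
  rcases Nat.eq_zero_or_pos m with rfl | hm
  · simp [term_zero]
  · rw [term_of_ne_zero hm.ne', logMul_iterate_apply]
    have hm0 : (0 : ℝ) ≤ m := Nat.cast_nonneg m
    rw [show (m : ℂ) = ((m : ℝ) : ℂ) by norm_cast, ← Complex.ofReal_log hm0,
      ← Complex.ofReal_cpow hm0, Complex.ofReal_div, Complex.ofReal_mul, Complex.ofReal_pow]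
    ring

/-- `Re L(logʲ·Λ)(a) = Σ_m Λ(m) (log m)^j / m^a` for real `a` (all terms are real).
[cite: Sekatskii2014, Thm 7, eq. (10) (the prime sums)] -/
theorem re_LSeries_logPow_vonMangoldt (a : ℝ) (j : ℕ) :
    (L (logMul^[j] ↗Λ) (a : ℂ)).re =
      ∑' m : ℕ, (ArithmeticFunction.vonMangoldt m : ℝ) * Real.log m ^ j / (m : ℝ) ^ a := by
  rw [LSeries]
  simp_rw [term_logPow_vonMangoldt a j]
  rw [← Complex.ofReal_tsum, Complex.ofReal_re]

/-- The prime-sum piece with its coefficient, real part: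
`Re[C(n,j+1)(2a−1)^{j+1}/j! · (−1)^{j+1} L(logʲΛ)(a)] = C(n,j+1)(2a−1)^{j+1}((−1)^{j+1}/j!) Σ_m Λ(m)logʲm/m^a`.
[cite: Sekatskii2014, Thm 7, eq. (10) (the prime sums)] -/
private theorem re_coeff_mul_LPiece (a : ℝ) (n j : ℕ) :
    ((n.choose (j + 1) : ℂ) * (2 * a - 1) ^ (j + 1) / (j ! : ℂ) *
        ((-1) ^ (j + 1) * L (logMul^[j] ↗Λ) a)).re =
      (n.choose (j + 1) : ℝ) * (2 * a - 1) ^ (j + 1) * ((-1) ^ (j + 1) / (j ! : ℝ)) *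
        ∑' m : ℕ, (ArithmeticFunction.vonMangoldt m : ℝ) * Real.log m ^ j / (m : ℝ) ^ a := by
  rw [show (n.choose (j + 1) : ℂ) * (2 * a - 1) ^ (j + 1) / (j ! : ℂ) *
        ((-1) ^ (j + 1) * L (logMul^[j] ↗Λ) a) =
      (((n.choose (j + 1) : ℝ) * (2 * a - 1) ^ (j + 1) * ((-1) ^ (j + 1) / (j ! : ℝ)) : ℝ) : ℂ) *
        L (logMul^[j] ↗Λ) a by push_cast; ring,
    Complex.re_ofReal_mul, re_LSeries_logPow_vonMangoldt]

/-- The digamma piece at `j = 0` with its coefficient `C(n,1)(2a−1) = n(2a−1)`, real part: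
`Re[n(2a−1)(−½ log π + ½ψ(a/2))] = (n/2)(2a−1)(Re ψ(a/2) − log π)`.
[cite: Sekatskii2014, Thm 7, eq. (10) (the term (n/2)(2a−1)(ψ(a/2) − ln π))] -/
private theorem re_coeff_mul_digammaPiece_zero (a : ℝ) (n : ℕ) :
    ((n.choose (0 + 1) : ℂ) * (2 * a - 1) ^ (0 + 1) / (0 ! : ℂ) *
        iteratedDeriv 0 (fun s : ℂ ↦ -(Real.log Real.pi : ℂ) / 2 + digamma (s / 2) / 2) a).re =
      (n : ℝ) / 2 * (2 * a - 1) * ((digamma ((a / 2 : ℝ) : ℂ)).re - Real.log Real.pi) := by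
  rw [iteratedDeriv_zero]
  simp only [zero_add, Nat.choose_one_right, pow_one, Nat.factorial_zero, Nat.cast_one, div_one]
  rw [show (n : ℂ) * (2 * a - 1) * (-(Real.log Real.pi : ℂ) / 2 + digamma ((a : ℂ) / 2) / 2) =
      (((n : ℝ) / 2 * (2 * a - 1) : ℝ) : ℂ) * (digamma ((a / 2 : ℝ) : ℂ) - (Real.log Real.pi : ℂ)) by
        push_cast; ring,
    Complex.re_ofReal_mul, Complex.sub_re, Complex.ofReal_re]

/-- The digamma piece at `j ≥ 1` with its coefficient, real part: by the polygamma series,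
`Re[C(n,j+1)(2a−1)^{j+1}/j! · (ψ(·/2)/2)^{(j)}(a)] = C(n,j+1)(−1)^{j+1}(2a−1)^{j+1}2^{−j−1} Σ_{m≥0}(m+a/2)^{−j−1}`
(the Hurwitz value `ζ(j+1, a/2)`). [cite: Sekatskii2014, Thm 7, eq. (10) (the terms ς(j, a/2))] -/
private theorem re_coeff_mul_digammaPiece {a : ℝ} (ha : 1 < a) (n : ℕ) {j : ℕ} (hj : 1 ≤ j) :
    ((n.choose (j + 1) : ℂ) * (2 * a - 1) ^ (j + 1) / (j ! : ℂ) *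
        iteratedDeriv j (fun s : ℂ ↦ -(Real.log Real.pi : ℂ) / 2 + digamma (s / 2) / 2) a).re =
      (n.choose (j + 1) : ℝ) * (-1) ^ (j + 1) * (2 * a - 1) ^ (j + 1) / 2 ^ (j + 1) *
        ∑' m : ℕ, 1 / ((m : ℝ) + a / 2) ^ (j + 1) := by
  have ha0 : 0 < ((a : ℂ)).re := by simp; linarith
  have hD := hasSum_iteratedDeriv_digamma_half ha0 hj
  rw [iteratedDeriv_const_add hj]
  have h2 := hD.mul_left ((n.choose (j + 1) : ℂ) * (2 * a - 1) ^ (j + 1) / (j ! : ℂ))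
  set r : ℕ → ℝ := fun m ↦ (n.choose (j + 1) : ℝ) * (-1) ^ (j + 1) * (2 * a - 1) ^ (j + 1) /
    2 ^ (j + 1) * (1 / ((m : ℝ) + a / 2) ^ (j + 1)) with hr
  have h3 : ∀ m : ℕ, (n.choose (j + 1) : ℂ) * (2 * a - 1) ^ (j + 1) / (j ! : ℂ) *
      ((-1) ^ (j + 1) * (j ! : ℂ) * ((((a : ℂ)) + 2 * m) ^ (j + 1))⁻¹) = ((r m : ℝ) : ℂ) := by
    intro m
    have hj0 : (j ! : ℂ) ≠ 0 := by exact_mod_cast (Nat.factorial_pos j).ne'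
    have hm' : ((m : ℝ) + a / 2) ≠ 0 := by positivity
    have hm : ((m : ℂ) + a / 2) ≠ 0 := by exact_mod_cast hm'
    rw [hr, show ((a : ℂ)) + 2 * m = 2 * ((m : ℂ) + a / 2) by ring, mul_pow]
    push_cast
    field_simp
  simp_rw [h3] at h2
  have h4 := Complex.hasSum_re h2
  simp only [Complex.ofReal_re] at h4
  rw [← h4.tsum_eq]
  exact tsum_mul_left

/-- The rational piece with its coefficients, summed by the binomial theorem:
`Σ_{j<n} C(n,j+1)(2a−1)^{j+1}/j! · (−1)^j j!(a^{−j−1} + (a−1)^{−j−1}) = 2 − (−1+1/a)ⁿ − (−1−1/(a−1))ⁿ`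
(Sekatskii's binomial sums, p. 429 top). [cite: Sekatskii2014, §4, p. 429 (the displays before Thm 7)] -/
private theorem sum_coeff_mul_ratPiece {a : ℝ} (ha : 1 < a) (n : ℕ) :
    ∑ j ∈ Finset.range n, (n.choose (j + 1) : ℂ) * (2 * a - 1) ^ (j + 1) / (j ! : ℂ) *
        ((-1) ^ j * j ! * ((((a : ℂ))⁻¹) ^ (j + 1) + (((a : ℂ) - 1)⁻¹) ^ (j + 1))) =
      ((2 - (-1 + 1 / a) ^ n - (-1 - 1 / (a - 1)) ^ n : ℝ) : ℂ) := by
  have hane : (a : ℂ) ≠ 0 := Complex.ofReal_ne_zero.2 (by linarith)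
  have hane1 : (a : ℂ) - 1 ≠ 0 := by
    rw [← Complex.ofReal_one, ← Complex.ofReal_sub]; exact Complex.ofReal_ne_zero.2 (by linarith)
  have hterm : ∀ j ∈ Finset.range n,
      (n.choose (j + 1) : ℂ) * (2 * a - 1) ^ (j + 1) / (j ! : ℂ) *
        ((-1) ^ j * j ! * ((((a : ℂ))⁻¹) ^ (j + 1) + (((a : ℂ) - 1)⁻¹) ^ (j + 1))) =
      (n.choose (j + 1) : ℂ) * ((-1) ^ j * ((2 * a - 1) / a) ^ (j + 1)) +
        (n.choose (j + 1) : ℂ) * ((-1) ^ j * ((2 * a - 1) / (a - 1)) ^ (j + 1)) := by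
    intro j _
    have hj0 : (j ! : ℂ) ≠ 0 := by exact_mod_cast (Nat.factorial_pos j).ne'
    rw [div_pow, div_pow, inv_pow, inv_pow]
    field_simp
  rw [Finset.sum_congr rfl hterm, Finset.sum_add_distrib, sum_range_choose_succ_mul_neg_pow,
    sum_range_choose_succ_mul_neg_pow]
  have e1 : (1 : ℂ) - (2 * a - 1) / a = -1 + 1 / a := by field_simp; ring
  have e2 : (1 : ℂ) - (2 * a - 1) / (a - 1) = -1 - 1 / (a - 1) := by field_simp; ring
  rw [e1, e2]
  push_cast
  ring

/-! ## Re-indexing the finite sums of `liSekatskiiArith` -/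

/-- `Σ_{j=1}^{n} F(j) = Σ_{i<n} F(i+1)`. [folklore] -/
private theorem sum_Icc_one_eq_sum_range {M : Type*} [AddCommMonoid M] (F : ℕ → M) (n : ℕ) :
    ∑ j ∈ Finset.Icc 1 n, F j = ∑ i ∈ Finset.range n, F (i + 1) := by
  rw [← Finset.Ico_add_one_right_eq_Icc, Finset.sum_Ico_eq_sum_range,
    show n + 1 - 1 = n by omega]
  exact Finset.sum_congr rfl fun i _ ↦ by rw [add_comm]

/-- `Σ_{j=2}^{k+1} F(j) = Σ_{i<k} F(i+1+1)`. [folklore] -/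
private theorem sum_Icc_two_eq_sum_range {M : Type*} [AddCommMonoid M] (F : ℕ → M) (k : ℕ) :
    ∑ j ∈ Finset.Icc 2 (k + 1), F j = ∑ i ∈ Finset.range k, F (i + 1 + 1) := by
  rw [← Finset.Ico_add_one_right_eq_Icc, Finset.sum_Ico_eq_sum_range,
    show k + 1 + 1 - 2 = k by omega]
  exact Finset.sum_congr rfl fun i _ ↦ by rw [show 2 + i = i + 1 + 1 by omega]

/-! ## Theorem 7 -/

/-- **Sekatskii 2014, Theorem 7, eq. (10) (p. 429)** — DISCHARGED: for real `a > 1` and `n ≥ 1`,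
`k_{n,a} = liSekatskiiArith a n`, i.e.
`Σ_ρ(1 − ((ρ−a)/(ρ+a−1))ⁿ) = 2 − (−1 + 1/a)ⁿ − (−1 − 1/(a−1))ⁿ
  + Σ_{j=1}^{n} C(n,j)(2a−1)^j ((−1)^j/(j−1)!) Σ_m Λ(m) ln^{j−1}m/m^a
  + (n/2)(2a−1)(ψ(a/2) − ln π) + Σ_{j=2}^{n} C(n,j)(−1)^j 2^{−j}(2a−1)^j ζ(j, a/2)`.
Proof by the road of the module docstring (eq. (6) + `ξ(z) = ξ(1−z)` + Leibniz + the three explicit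
`j`-th derivatives of the pieces of `ξ'/ξ` at `a`), not by Sekatskii's explicit-formula computation;
the closed terms are his binomial sums of p. 429. [cite: Sekatskii2014, Thm 7, eq. (10) p. 429] -/
theorem _root_.Literature.NumberTheory.LFunctions.Sekatskii2014_thm7_holds : Sekatskii2014_thm7 := by
  intro a ha n hn
  obtain ⟨k, rfl⟩ : ∃ k, n = k + 1 := ⟨n - 1, by omega⟩
  rw [liSekatskiiSum_eq_deriv Sekatskii2014_sum_eq_deriv_holds a hn, liSekatskiiDeriv,
    ← Complex.re_ofReal_mul, key_sum a hn]
  -- substitute the derivatives of `ξ'/ξ` at `a`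
  have hE : ∀ j ∈ Finset.range (k + 1),
      ((k + 1).choose (j + 1) : ℂ) * (2 * a - 1) ^ (j + 1) / (j ! : ℂ) *
          iteratedDeriv j (logDeriv riemannXi) a =
        ((k + 1).choose (j + 1) : ℂ) * (2 * a - 1) ^ (j + 1) / (j ! : ℂ) *
            ((-1) ^ j * j ! * ((((a : ℂ))⁻¹) ^ (j + 1) + (((a : ℂ) - 1)⁻¹) ^ (j + 1))) +
          ((k + 1).choose (j + 1) : ℂ) * (2 * a - 1) ^ (j + 1) / (j ! : ℂ) *
            iteratedDeriv j (fun s : ℂ ↦ -(Real.log Real.pi : ℂ) / 2 + digamma (s / 2) / 2) a +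
          ((k + 1).choose (j + 1) : ℂ) * (2 * a - 1) ^ (j + 1) / (j ! : ℂ) *
            ((-1) ^ (j + 1) * L (logMul^[j] ↗Λ) a) := by
    intro j _
    rw [iteratedDeriv_logDeriv_riemannXi ha j, pow_succ]
    ring
  rw [Finset.sum_congr rfl hE, Finset.sum_add_distrib, Finset.sum_add_distrib,
    sum_coeff_mul_ratPiece ha (k + 1), Complex.add_re, Complex.add_re, Complex.ofReal_re,
    Complex.re_sum, Complex.re_sum,
    Finset.sum_range_succ' (fun j ↦ (((k + 1).choose (j + 1) : ℂ) * (2 * a - 1) ^ (j + 1) /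
      (j ! : ℂ) * iteratedDeriv j
        (fun s : ℂ ↦ -(Real.log Real.pi : ℂ) / 2 + digamma (s / 2) / 2) a).re),
    re_coeff_mul_digammaPiece_zero a (k + 1),
    Finset.sum_congr rfl fun j _ ↦ re_coeff_mul_digammaPiece ha (k + 1) (by omega : 1 ≤ j + 1),
    Finset.sum_congr rfl fun j _ ↦ re_coeff_mul_LPiece a (k + 1) j]
  -- the printed right-hand side, re-indexed
  unfold liSekatskiiArith
  rw [sum_Icc_one_eq_sum_range, sum_Icc_two_eq_sum_range]
  simp only [Nat.add_sub_cancel]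
  push_cast
  ring

/-- **RH as positivity of Sekatskii's arithmetic expression**, hypothesis-free (Theorem 1 + Theorem 7):
for every real `a > 1`, `RH ⟺ ∀ n ≥ 1, liSekatskiiArith a n ≥ 0`.  RH-EQUIVALENT record proved AS an
equivalence; neither side is asserted; the positivity of the whole family is RH itself.
[cite: Sekatskii2014, Thm 1 and Thm 7 (§4)] -/
theorem _root_.Literature.NumberTheory.LFunctions.riemannHypothesis_iff_liSekatskiiArith_nonneg'
    {a : ℝ} (ha : 1 < a) :
    RiemannHypothesis ↔ ∀ n : ℕ, 1 ≤ n → 0 ≤ liSekatskiiArith a n :=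
  riemannHypothesis_iff_liSekatskiiArith_nonneg Sekatskii2014_thm7_holds ha

end Sekatskii2014Thm7

end Literature.NumberTheory.LFunctions
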